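import Summits.ValiantsHypothesis.ValiantsHypothesis.Theorems.VPBoundarySquareCHAlgebraicHalf
import Summits.ValiantsHypothesis.ValiantsHypothesis.Theorems.VPBoundarySquareNbNormalFormIff
import Summits.ValiantsHypothesis.ValiantsHypothesis.Theorems.DefinabilityGapTauCut
import HarnessLib

/-!
# VP-boundary square — the BOOLEAN SLOT of `B_nb` (`CH/poly ⊆ P/poly ⟹ B_nb`) and the τ-slot

Route `VPBoundarySquare`; cell W18 (`BooleanNbDefinable`, «B_nb»), CH-corner W22
(`CHClosureDefinable`, «U_CH»), constant-free column G6 (`VP0EqVNP0`, «W0»).  GRH entered the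
lineage at one place: `ERH → VP ℂ = VNP ℂ → CH ⊆ P/poly`.  Bürgisser's printed proof outline of
Thm. 4.10 (arXiv:2406.06217 p. 17) runs «collapse ⟹ #P ⊆ P/poly ⟹ CH collapses to P/poly ⟹
monomials computable in P/poly ⟹ (collapse AGAIN) normal form `z ↦ x^{2^ℓ}` from a VP family»;
this file types that kernel with the algebraic collapse REMOVED from the normal-form step:
* §1 `powerSubst_of_expFormat_of_PPoly` (collapse-free engine: inner family in `VNP^ℂ`);
* §2 (mod the GRH-free named fact `Bur26_cor_4_10 : VNPnb⁰ ⊆ VCH⁰`, a HYPOTHESIS `h410`)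
  `CH/poly ⊆ P/poly → B_nb`, hence `B_nb` from `PP ⊆ P/poly`, from `τ(per)` p-bounded (constant
  elimination, `DefinabilityGapTauCut` BY NAME), from `VP⁰ = VNP⁰`; `¬B_nb → PP ⊄ P/poly ∧ VP⁰ ≠
  VNP⁰`; `B_nb ∨ VP⁰ ≠ VNP⁰`; the completion ladder `U ↔ U_CH` under `CH/poly ⊆ P/poly`;
* §3 (fact-free) `Q ∧ U_CH → ¬ IsPBounded τ(per) → VP⁰ ≠ VNP⁰`; `P ⟸ U_CH ∧ (VP = VNP → τ bdd)`.
GRADE (critic CALL O-L3-20): mechanism PRINT (Bür24 Thm 4.10 outline; Bür09 L2.5/2.12; BIJL18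
L25); VARIANT = hypothesis isolation (Boolean collapse alone; mixed ⁰ → ℂ form not stated in
print); rung 0; 0 S-currency; closes no item; B_nb, U_CH, Q, PP ⊄ P/poly, VP ≠ VNP UNTOUCHED;
h410 = Bur26_cor_4_10 is a HYPOTHESIS.  No `def`, no `def … : Prop`, no new named facts.
[cite: Burgisser2024Completeness, Prop. 3.1, Cor. 4.7, Thm. 4.10 + outline (p0017 L78–L101)]
[cite: Burgisser2026HNC, Cor. 4.10, Lemma 4.11, Cor. 4.12 (pp. 13–14)] [cite: Tavenas2014,
Prop. 3.17] [cite: Burgisser2006, Lemma 2.12, Lemma 2.5] [cite: BlaserIkenmeyerJindalLysikov2018,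
Lemma 25] [cite: Burgisser2000, Cor. 1.2]
-/

noncomputable section

set_option linter.dupNamespace false

open MvPolynomial Finset
open Literature.Computability.AlgebraicComplexity
open Literature.Computability.Complexity
open Literature.Barriers.ValiantsHypothesis (VP0EqVNP0
  isPBounded_constantFreeComplexity_perPoly_of_vp0EqVNP0)

namespace Summit.ValiantsHypothesis.ValiantsHypothesis.Theorems.VPBoundarySquareNbBooleanSlot

open Summit.ValiantsHypothesis.ValiantsHypothesis.Theses.VPBoundarySquare
open Summit.ValiantsHypothesis.ValiantsHypothesis.Theorems.VPBoundarySquareCompletionLadder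
open Summit.ValiantsHypothesis.ValiantsHypothesis.Theorems.VPBoundarySquareCHAlgebraicHalf
open Summit.ValiantsHypothesis.ValiantsHypothesis.Theorems.VPBoundarySquareKroneckerVNP
open Summit.ValiantsHypothesis.ValiantsHypothesis.Theorems.VPBoundarySquareCoeffQueryFP
open Summit.ValiantsHypothesis.ValiantsHypothesis.Theorems.VPBoundarySquareNbTruncation
open Summit.ValiantsHypothesis.ValiantsHypothesis.Theorems.VPBoundarySquareNbNormalFormIff
open Summit.ValiantsHypothesis.ValiantsHypothesis.Theorems.DefinabilityGapTauCut

/-! ## §1. Collapse-free engine -/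

/-- **Collapse-free engine.**  A `P/poly`-coefficient exponential-format specialisation
`n ↦ (map ℤ→ℂ Qₙ)(X, κₙ)` is a `p`-bounded power substitution `z ↦ X_{v z}^{2^{ℓ z}}` of a `VNP^ℂ`
family: Kronecker-pack `Qₙ` (digit base `2^{pₙ+1}`), take Tavenas' generic `hPoly Φ ∈ VNP` with the
`P/poly` bit language, and specialise it PARTIALLY (constant bit-variables `↦ κ^{2^j}`, weights
`z_l ↦ 2^{2^l}`, the bit-variable `x_{i,j}` of an input to a fresh `Z_{(i,j)}`; `Z_{(i,j)} ↦ Xᵢ^{2^j}`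
recovers `theta`).  The Tavenas data block is re-typed: internal haves of CHAlgebraicHalf l.71–125
not citable; re-typed.  [cite: Burgisser2024Completeness, Cor. 4.7, Thm. 4.10 outline (p0017)]
[cite: Burgisser2026HNC, Lemma 4.11 (p. 13)] [cite: Tavenas2014, Prop. 3.17] -/
theorem powerSubst_of_expFormat_of_PPoly {w m : ℕ → ℕ}
    {Q : ∀ n, MvPolynomial (Fin (w n + m n)) ℤ} (hfmt : IsExpFormat Q)
    (hco : HasCoeffFnIn PPoly Q) (κ : ∀ n, Fin (m n) → ℂ) :
    ∃ (a : ℕ → ℕ) (g : ∀ n, MvPolynomial (Fin (a n)) ℂ) (v : ∀ n, Fin (a n) → Fin (w n))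
      (ℓ : ∀ n, Fin (a n) → ℕ), IsVNPFamily g ∧ (IsPBounded fun n => Finset.univ.sup (ℓ n)) ∧
        ∀ n, aeval (Fin.append X fun j => C (κ n j)) (map (Int.castRingHom ℂ) (Q n)) =
          MvPolynomial.aeval (fun z => (X (v n z) : MvPolynomial (Fin (w n)) ℂ) ^ 2 ^ ℓ n z)
            (g n) := by
  classical
  obtain ⟨p, hp, hpf⟩ := hfmt
  obtain ⟨L, hL, hLQ⟩ := hco
  have hu : IsPBounded fun n => w n + m n := hp.mono fun n => (hpf n).1
  have hw : IsPBounded w := hu.mono fun n => Nat.le_add_right _ _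
  have hδ : IsPBounded fun n => p n + 1 := IsPBounded.add_holds hp (IsPBounded.const 1)
  have hud : IsPBounded fun n => (w n + m n) * (p n + 1) := IsPBounded.mul_holds hu hδ
  obtain ⟨pp, hpp⟩ := (isPBounded_iff_exists_polynomial_holds _).1 hud
  -- the overflow bit `2^(p n + 1)` of every coefficient is `false`
  have hfalse : ∀ n, coeffFnBit (Q n) 0 (2 ^ (p n + 1)) = false := by
    intro n
    obtain ⟨a, ha⟩ : ∃ a, 2 ^ (p n + 1) = a + 1 :=
      ⟨2 ^ (p n + 1) - 1, by have := Nat.one_le_two_pow (n := p n + 1); omega⟩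
    rw [ha]
    show (coeff 0 (Q n)).natAbs.testBit a = false
    apply Nat.testBit_lt_two_pow
    refine ((hpf n).2.2 0).trans_le (Nat.pow_le_pow_right two_pos ?_)
    have : 2 ^ (p n + 1) = 2 * 2 ^ p n := by ring
    omega
  obtain ⟨B, hB, hBQ⟩ := exists_encUQuery_language (fun n => p n + 1) hu hδ Q hL hLQ hfalse
  obtain ⟨pB, hSIZE⟩ := Set.mem_iUnion.1 hB
  obtain ⟨CF, hCF, hdec⟩ := hSIZE
  -- Tavenas' data for the packed family (as in `…CHAlgebraicHalf`, whose record is proof-internal)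
  obtain ⟨Φ, hΦf, hΦd, hΦr⟩ : ∃ Φ : DefVNP.FamilyData,
      (∀ n, Φ.f n = kron (2 ^ (p n + 1)) (Q n)) ∧ (∀ n, Φ.d n = (w n + m n) * (p n + 1)) ∧
      (∀ n, Φ.r n = p n) := by
    refine ⟨{ f := fun n => kron (2 ^ (p n + 1)) (Q n)
              d := fun n => (w n + m n) * (p n + 1)
              r := p
              hd := hud
              hr := hp
              p := pp
              B := B
              pB := pB
              CF := CF
              hCF := hCF
              hdec := hdec
              hp := fun n => (natDegree_kron_lt (Q n) (by positivity)).trans_le (by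
                rw [← pow_mul, mul_comm]
                exact Nat.pow_le_pow_right two_pos (hpp n))
              hB := fun n α j hα => ?_
              hdeg := fun n => by
                show (kron (2 ^ (p n + 1)) (Q n)).natDegree < 2 ^ ((w n + m n) * (p n + 1))
                rw [mul_comm, pow_mul]
                exact natDegree_kron_lt (Q n) (by positivity)
              hcoeff := fun n α => natAbs_coeff_kron_le (Q n) α (hpf n).2.2 },
      fun _ => rfl, fun _ => rfl, fun _ => rfl⟩
    show encUQuery n α j ∈ B ↔ sbit ((kron (2 ^ (p n + 1)) (Q n)).coeff α) j = true
    rw [hBQ n α j]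
    constructor
    · rintro ⟨hlt, hbit⟩
      rw [coeff_kron_of_lt (Q n) hlt, fs_symm_eq_dig hlt, sbit_coeff_eq_coeffFnBit]
      exact hbit
    · intro h
      by_cases hlt : α < (2 ^ (p n + 1)) ^ (w n + m n)
      · rw [coeff_kron_of_lt (Q n) hlt, fs_symm_eq_dig hlt, sbit_coeff_eq_coeffFnBit] at h
        exact ⟨hlt, h⟩
      · rw [coeff_kron, dif_neg hlt] at h
        cases j <;> simp [sbit] at h
  -- the PARTIAL substitution: input bit-variables kept (renamed to `Fin (w n * (p n + 1))`),
  -- constant bit-variables `↦ κ^{2^j}`, weight variables `z_l ↦ 2^{2^l}`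
  let ψ : ∀ n, DefVNP.XZ (DefVNP.params Φ n) → MvPolynomial (Fin (w n * (p n + 1))) ℂ :=
    fun n => Sum.elim
      (fun t : Fin (DefVNP.params Φ n).D => Fin.append
        (fun i' : Fin (w n) => (X (finProdFinEquiv
          (i', (finProdFinEquiv.symm (Fin.cast (hΦd n) t)).2)) :
            MvPolynomial (Fin (w n * (p n + 1))) ℂ))
        (fun j' : Fin (m n) =>
          C (κ n j' ^ 2 ^ ((finProdFinEquiv.symm (Fin.cast (hΦd n) t)).2 : ℕ)))
        (finProdFinEquiv.symm (Fin.cast (hΦd n) t)).1)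
      (fun l : Fin (DefVNP.params Φ n).R =>
        C ((2 : ℂ) ^ 2 ^ (l : ℕ)))
  have hψ : ∀ n x, complexity (ψ n x) = 0 ∧ (ψ n x).totalDegree ≤ 1 := by
    intro n x
    rcases x with t | l
    · simp only [ψ, Sum.elim_inl]
      generalize finProdFinEquiv.symm (Fin.cast (hΦd n) t) = q
      obtain ⟨i, j⟩ := q
      dsimp only
      induction i using Fin.addCases with
      | left i' => rw [Fin.append_left]
                   exact ⟨complexity_X_holds _, mvPolynomial_totalDegree_X_le_one _⟩
      | right j' => rw [Fin.append_right, totalDegree_C]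
                    exact ⟨complexity_C_holds _, Nat.zero_le _⟩
    · simp only [ψ, Sum.elim_inr, totalDegree_C]
      exact ⟨complexity_C_holds _, Nat.zero_le _⟩
  -- composing with `Z_{(i,j)} ↦ Xᵢ^{2^j}` recovers `theta`
  have hψθ : ∀ n, (fun x => aeval (fun z : Fin (w n * (p n + 1)) =>
      (X (finProdFinEquiv.symm z).1 : MvPolynomial (Fin (w n)) ℂ) ^
        2 ^ ((finProdFinEquiv.symm z).2 : ℕ)) (ψ n x)) =
      theta ℂ Φ n (hΦd n) (Fin.append X fun j => C (κ n j)) := by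
    intro n
    funext x
    rcases x with t | l
    · simp only [ψ, Sum.elim_inl, theta_inl]
      generalize finProdFinEquiv.symm (Fin.cast (hΦd n) t) = q
      obtain ⟨i, j⟩ := q
      dsimp only
      induction i using Fin.addCases with
      | left i' => simp only [Fin.append_left, aeval_X, Equiv.symm_apply_apply]
      | right j' => simp only [Fin.append_right, aeval_C, MvPolynomial.algebraMap_eq, map_pow]
    · simp only [ψ, Sum.elim_inr, theta_inr, aeval_C]
  -- exponents of `Qₙ` fit into one digit
  have hsupp : ∀ n, ∀ e ∈ (Q n).support, ∀ i, e i < 2 ^ (p n + 1) := by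
    intro n e he i
    calc e i ≤ degreeOf i (Q n) := monomial_le_degreeOf i he
      _ ≤ (Q n).totalDegree := degreeOf_le_totalDegree _ _
      _ ≤ 2 ^ p n := (hpf n).2.1
      _ < 2 ^ (p n + 1) := Nat.pow_lt_pow_right (by norm_num) (by omega)
  refine ⟨fun n => w n * (p n + 1), fun n => aeval (ψ n) (DefVNP.hPoly (k := ℂ) Φ n),
    fun n z => (finProdFinEquiv.symm z).1, fun n z => ((finProdFinEquiv.symm z).2 : ℕ),
    ?_, ?_, fun n => ?_⟩
  · -- `hPoly Φ ∈ VNP` (Tavenas) and `VNP` is closed under the free, degree-one substitution `ψ`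
    exact isVNPFamily_aeval (DefVNP.isVNPFamily_hPoly Φ) ψ
      ((IsPBounded.mul_holds hw hδ).mono fun n => by simp)
      ((IsPBounded.const 0).mono fun n => (Finset.sum_eq_zero fun x _ => (hψ n x).1).le)
      (IsPBounded.const 1) fun n x => (hψ n x).2
  · -- `ℓ ≤ p n`
    exact hp.mono fun n => Finset.sup_le fun z _ => Nat.le_of_lt_succ (finProdFinEquiv.symm z).2.isLt
  · -- the substitution identity: `aeval F (aeval ψ H) = aeval (aeval F ∘ ψ) H = aeval theta H`
    beta_reduce
    rw [show aeval (ψ n) (DefVNP.hPoly (k := ℂ) Φ n) = bind₁ (ψ n) (DefVNP.hPoly (k := ℂ) Φ n)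
      from rfl, aeval_bind₁, hψθ n]
    exact (aeval_theta_hPoly ℂ Φ n (hΦd n) (Q n) (hΦf n) (hsupp n) _).symm

/-- **A p-family that is a `p`-bounded power substitution of a `VNP^ℂ` family is in `VNP^ℂ`**
(char. 0): light substitution (heavy `z ↦ 0`), `isVNPFamily_aeval`, truncation `isVNPFamily_truncate`
(Prop. 3.1), comparison `truncSum_aeval_light` — single-family form of the body of
`booleanNbDefinable_of_nbNormalForm`. [cite: Burgisser2024Completeness, Prop. 3.1, §4.2 (p0017)] -/
theorem isVNPFamily_of_powerSubst {w a : ℕ → ℕ} {f : ∀ n, MvPolynomial (Fin (w n)) ℂ}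
    (hpf : IsPFamily f) {g : ∀ n, MvPolynomial (Fin (a n)) ℂ} (hg : IsVNPFamily g)
    (v : ∀ n, Fin (a n) → Fin (w n)) {ℓ : ∀ n, Fin (a n) → ℕ}
    (hℓ : IsPBounded fun n => Finset.univ.sup (ℓ n))
    (hfg : ∀ n, f n = MvPolynomial.aeval
      (fun z => (X (v n z) : MvPolynomial (Fin (w n)) ℂ) ^ 2 ^ ℓ n z) (g n)) :
    IsVNPFamily f := by
  obtain ⟨hw, hdeg⟩ := hpf
  have ha : IsPBounded a := hg.1.1.mono fun n => by simp
  -- the light substitution `θ`: heavy variables (`2^{ℓ z} > deg f_n`) go to `0`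
  let θ : ∀ n, Fin (a n) → MvPolynomial (Fin (w n)) ℂ := fun n z =>
    if 2 ^ ℓ n z ≤ (f n).totalDegree then (X (v n z) : MvPolynomial (Fin (w n)) ℂ) ^ 2 ^ ℓ n z
    else 0
  have hF : IsVNPFamily fun n => aeval (θ n) (g n) := by
    refine isVNPFamily_aeval hg θ hw ((IsPBounded.mul_holds ha hℓ).mono fun n => ?_) hdeg
      (fun n z => ?_)
    · -- `Σ_z L(θ_z) ≤ a_n · max_z ℓ z`
      calc ∑ z, complexity (θ n z) ≤ ∑ _z : Fin (a n), Finset.univ.sup (ℓ n) :=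
            Finset.sum_le_sum fun z _ => by
              dsimp only [θ]
              split_ifs
              · exact (complexity_X_pow_two_pow_le _ _).trans (Finset.le_sup (Finset.mem_univ z))
              · rw [← C_0, complexity_C_holds]
                exact Nat.zero_le _
        _ = a n * Finset.univ.sup (ℓ n) := by simp
    · -- `deg θ_z ≤ deg f_n`
      dsimp only [θ]
      split_ifs with h
      · rwa [totalDegree_X_pow]
      · rw [totalDegree_zero]
        exact Nat.zero_le _
  have hT := isVNPFamily_truncate hF hdeg
  have key : f = fun n => ∑ j ∈ range ((f n).totalDegree + 1),
      homogeneousComponent j (aeval (θ n) (g n)) := by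
    funext n
    dsimp only [θ]
    rw [truncSum_aeval_light, ← hfg n, sum_homogeneousComponent]
  rw [key]
  exact hT

/-- `P/poly`-coefficient exponential-format specialisations that are p-families are in `VNP^ℂ` —
collapse-free (contrast `isPComputable_aeval_of_expFormat_of_PPoly`: `VP` under the collapse). -/
theorem isVNPFamily_aeval_of_expFormat_of_PPoly {w m : ℕ → ℕ}
    {Q : ∀ n, MvPolynomial (Fin (w n + m n)) ℤ} (hfmt : IsExpFormat Q)
    (hco : HasCoeffFnIn PPoly Q) (κ : ∀ n, Fin (m n) → ℂ)
    (hpf : IsPFamily fun n => aeval (Fin.append X fun j => C (κ n j)) (map (Int.castRingHom ℂ) (Q n))) :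
    IsVNPFamily fun n => aeval (Fin.append X fun j => C (κ n j)) (map (Int.castRingHom ℂ) (Q n)) := by
  obtain ⟨a, g, v, ℓ, hg, hℓ, hfg⟩ := powerSubst_of_expFormat_of_PPoly hfmt hco κ
  exact isVNPFamily_of_powerSubst hpf hg v hℓ hfg

/-- Under `CH/poly ⊆ P/poly` every p-family with a `VCH⁰`-specialisation presentation is in
`VNP^ℂ`. [cite: Burgisser2026HNC, Lemma 4.11, Cor. 4.12 (pp. 13–14)] -/
theorem isVNPFamily_of_vchSpec_of_polyAdvice_CH (hCH : polyAdvice CH ⊆ PPoly) {w : ℕ → ℕ}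
    {g : ∀ n, MvPolynomial (Fin (w n)) ℂ} (hpf : IsPFamily g)
    (hpres : ∃ (m : ℕ → ℕ) (Q : ∀ n, MvPolynomial (Fin (w n + m n)) ℤ) (κ : ∀ n, Fin (m n) → ℂ),
      IsVCH0Family Q ∧ ∀ n, g n = MvPolynomial.aeval (Fin.append MvPolynomial.X fun j =>
        MvPolynomial.C (κ n j)) (MvPolynomial.map (Int.castRingHom ℂ) (Q n))) :
    IsVNPFamily g := by
  obtain ⟨m, Q, κ, hQ, hg⟩ := hpres
  have hfun : g = fun n => MvPolynomial.aeval (Fin.append MvPolynomial.X fun j =>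
      MvPolynomial.C (κ n j)) (MvPolynomial.map (Int.castRingHom ℂ) (Q n)) := funext hg
  rw [hfun] at hpf ⊢
  exact isVNPFamily_aeval_of_expFormat_of_PPoly hQ.1 (hQ.2.mono hCH) κ hpf

/-! ## §2. The Boolean slot: `CH/poly ⊆ P/poly ⟹ B_nb` (mod Bürgisser 2026 Cor. 4.10) -/

/-- **`CH/poly ⊆ P/poly ⟹ NF_ℂ`** (mod `h410`), verbatim shape of `…NbNormalFormIff`: the normal
form of Cor. 4.7 over `ℂ` from the Boolean collapse alone.
[cite: Burgisser2024Completeness, Cor. 4.7, Thm. 4.10 outline (p0017 L78–L90)] -/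
theorem nbNormalForm_of_polyAdvice_CH (h410 : Bur26_cor_4_10) (hCH : polyAdvice CH ⊆ PPoly) :
    ∀ (w : ℕ → ℕ) (f : ∀ n, MvPolynomial (Fin (w n)) ℂ), IsVNPnbFamily f →
      ∃ (a : ℕ → ℕ) (g : ∀ n, MvPolynomial (Fin (a n)) ℂ) (v : ∀ n, Fin (a n) → Fin (w n))
        (ℓ : ∀ n, Fin (a n) → ℕ), IsVNPFamily g ∧ (IsPBounded fun n => Finset.univ.sup (ℓ n)) ∧
          ∀ n, f n = MvPolynomial.aeval (fun z => (X (v n z) : MvPolynomial (Fin (w n)) ℂ) ^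
            2 ^ ℓ n z) (g n) := by
  intro w f hf
  have hw : IsPBounded w := by
    obtain ⟨u, g, hg, -⟩ := hf
    exact hg.1.mono fun n => by simp [Fintype.card_sum, Fintype.card_fin]
  obtain ⟨m, Q, κ, hQ, hfQ⟩ := vchSpec_of_isVNPnbFamily h410 hw hf
  obtain ⟨a, g, v, ℓ, hg, hℓ, hid⟩ := powerSubst_of_expFormat_of_PPoly hQ.1 (hQ.2.mono hCH) κ
  exact ⟨a, g, v, ℓ, hg, hℓ, fun n => (hfQ n).trans (hid n)⟩

/-- **The Boolean slot: `CH/poly ⊆ P/poly ⟹ B_nb`** (mod `h410`) — no algebraic collapse, no GRH.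
[cite: Burgisser2024Completeness, Thm. 4.10 + outline (p0017)] [cite: Burgisser2026HNC, Cor. 4.10] -/
theorem booleanNbDefinable_of_polyAdvice_CH (h410 : Bur26_cor_4_10) (hCH : polyAdvice CH ⊆ PPoly) :
    BooleanNbDefinable :=
  booleanNbDefinable_of_nbNormalForm (nbNormalForm_of_polyAdvice_CH h410 hCH)

/-- `PP ⊆ P/poly ⟹ B_nb` (mod `h410`). [cite: Burgisser2024Completeness, Thm. 4.10 outline] -/
theorem booleanNbDefinable_of_PP_subset_PPoly (h410 : Bur26_cor_4_10) (hPP : PP ⊆ PPoly) :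
    BooleanNbDefinable :=
  booleanNbDefinable_of_polyAdvice_CH h410
    (polyAdvice_subset_PPoly (CH_subset_PPoly_of_PP_subset_PPoly_holds hPP))

/-- `τ(per)` p-bounded `⟹ B_nb` (mod `h410`): constant elimination replaces GRH
(`polyAdvice_CH_subset_PPoly_of_tau`). [cite: Burgisser2006, Lemma 2.12, Lemma 2.5] -/
theorem booleanNbDefinable_of_tau (h410 : Bur26_cor_4_10)
    (hτ : IsPBounded (fun n => constantFreeComplexity (perPoly (Fin n) ℤ))) : BooleanNbDefinable :=
  booleanNbDefinable_of_polyAdvice_CH h410 (polyAdvice_CH_subset_PPoly_of_tau hτ)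

/-- `VP⁰ = VNP⁰ ⟹ B_nb` over `ℂ` (mod `h410`): the mixed `⁰ → ℂ` form of Thm. 4.10 (print: (1)
`⁰ → ⁰`, (2) GRH + `ℂ → ℂ`). [cite: Burgisser2024Completeness, Thm. 4.10]
[cite: BlaserIkenmeyerJindalLysikov2018, Lemma 25] -/
theorem booleanNbDefinable_of_vp0EqVNP0 (h410 : Bur26_cor_4_10) (h0 : VP0EqVNP0) :
    BooleanNbDefinable :=
  booleanNbDefinable_of_tau h410 (isPBounded_constantFreeComplexity_perPoly_of_vp0EqVNP0 h0)

/-- **Refuting `B_nb` proves a Boolean lower bound: `¬B_nb ⟹ PP ⊄ P/poly`** (mod `h410`). -/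
theorem not_PP_subset_PPoly_of_not_booleanNbDefinable (h410 : Bur26_cor_4_10)
    (hB : ¬ BooleanNbDefinable) : ¬ (PP ⊆ PPoly) :=
  fun hPP => hB (booleanNbDefinable_of_PP_subset_PPoly h410 hPP)

/-- `¬B_nb ⟹ τ(per)` not p-bounded (mod `h410`). -/
theorem not_isPBounded_tau_of_not_booleanNbDefinable (h410 : Bur26_cor_4_10)
    (hB : ¬ BooleanNbDefinable) :
    ¬ IsPBounded (fun n => constantFreeComplexity (perPoly (Fin n) ℤ)) :=
  fun hτ => hB (booleanNbDefinable_of_tau h410 hτ)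

/-- **`¬B_nb ⟹ VP⁰ ≠ VNP⁰`** (mod `h410`). [cite: BlaserIkenmeyerJindalLysikov2018, Lemma 25] -/
theorem not_vp0EqVNP0_of_not_booleanNbDefinable (h410 : Bur26_cor_4_10)
    (hB : ¬ BooleanNbDefinable) : ¬ VP0EqVNP0 :=
  fun h0 => not_isPBounded_tau_of_not_booleanNbDefinable h410 hB
    (isPBounded_constantFreeComplexity_perPoly_of_vp0EqVNP0 h0)

/-- **GRH-free dichotomy `B_nb ∨ VP⁰ ≠ VNP⁰`** (mod `h410`). -/
theorem booleanNbDefinable_or_not_vp0EqVNP0 (h410 : Bur26_cor_4_10) :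
    BooleanNbDefinable ∨ ¬ VP0EqVNP0 := by
  by_cases hB : BooleanNbDefinable
  · exact Or.inl hB
  · exact Or.inr (not_vp0EqVNP0_of_not_booleanNbDefinable h410 hB)

/-- Ladder collapse, fact-free: under `CH/poly ⊆ P/poly`, `U_CH ⟹ U`. -/
theorem closureDefinable_of_ch_of_polyAdvice_CH (hCH : polyAdvice CH ⊆ PPoly)
    (hU : CHClosureDefinable) : ClosureDefinable :=
  fun v f hpf hbar => isVNPFamily_of_vchSpec_of_polyAdvice_CH hCH hpf (hU v f hpf hbar)

/-- Under `CH/poly ⊆ P/poly`: `U ↔ U_CH` (mod `h410`). -/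
theorem closureDefinable_iff_ch_of_polyAdvice_CH (h410 : Bur26_cor_4_10)
    (hCH : polyAdvice CH ⊆ PPoly) : ClosureDefinable ↔ CHClosureDefinable :=
  ⟨fun hU => chClosureDefinable_of_nb h410 (nbClosureDefinable_of_closureDefinable hU),
    closureDefinable_of_ch_of_polyAdvice_CH hCH⟩

/-! ## §3. The τ-slot: GRH replaced by constant elimination (fact-free) -/

/-- `τ(per)` p-bounded `⟹ CH ⊆ P/poly` (Valiant; constant elimination; Toda), fact-free.
[cite: Burgisser2006, Lemma 2.12, Lemma 2.5] -/
theorem ch_subset_PPoly_of_tau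
    (hτ : IsPBounded (fun n => constantFreeComplexity (perPoly (Fin n) ℤ))) : CH ⊆ PPoly :=
  CH_subset_PPoly_of_PP_subset_PPoly_holds
    (PP_subset_PPoly_of_isPBounded_perPoly_of_valiant Valiant1979_per01Plain_isSharpPHardFun_holds hτ)

/-- **τ-slot of `P_CH`**: `τ(per)` p-bounded `⟹ P_CH` (verbatim `hP` shape of
`collapseEmptiesBoundary_of_ch`). [cite: Burgisser2026HNC, Cor. 4.12 (p. 14)] -/
theorem pCH_of_tau (hτ : IsPBounded (fun n => constantFreeComplexity (perPoly (Fin n) ℤ))) :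
    VP ℂ = VNP ℂ → ∀ (w : ℕ → ℕ) (g : ∀ n, MvPolynomial (Fin (w n)) ℂ), IsPFamily g →
      (∃ (m : ℕ → ℕ) (Q : ∀ n, MvPolynomial (Fin (w n + m n)) ℤ) (κ : ∀ n, Fin (m n) → ℂ),
        IsVCH0Family Q ∧ ∀ n, g n = MvPolynomial.aeval (Fin.append MvPolynomial.X fun j =>
          MvPolynomial.C (κ n j)) (MvPolynomial.map (Int.castRingHom ℂ) (Q n))) →
      IsPComputable g :=
  collapseDebordersCH_of_ch_subset_PPoly (ch_subset_PPoly_of_tau hτ)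

/-- **`Q ∧ U_CH ⟹ τ(per)` not p-bounded**, fact-free, GRH-free: else `VP ℂ = VNP ℂ`
(`vp_eq_vnp_of_tau`) and `P_CH` (`pCH_of_tau`), and the CH-corner gives `VP ℂ ≠ VNP ℂ`. -/
theorem not_isPBounded_tau_of_Q_of_ch (hQ : EmptyBoundarySeparates) (hU : CHClosureDefinable) :
    ¬ IsPBounded (fun n => constantFreeComplexity (perPoly (Fin n) ℤ)) :=
  fun hτ => valiant_of_Q_of_chCompletion hQ hU (pCH_of_tau hτ) (vp_eq_vnp_of_tau hτ)

/-- **`Q ∧ U_CH ⟹ VP⁰ ≠ VNP⁰`**, fact-free, GRH-free: the CH-corner decides constant-free Valiant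
unconditionally. [cite: BlaserIkenmeyerJindalLysikov2018, Lemma 25] -/
theorem not_vp0EqVNP0_of_Q_of_ch (hQ : EmptyBoundarySeparates) (hU : CHClosureDefinable) :
    ¬ VP0EqVNP0 :=
  fun h0 => not_isPBounded_tau_of_Q_of_ch hQ hU
    (isPBounded_constantFreeComplexity_perPoly_of_vp0EqVNP0 h0)

/-- **`P ⟸ U_CH ∧` constant elimination** (`VP ℂ = VNP ℂ → IsPBounded τ(per)`, the shape of
`Theses.TauConst.TauConstElim`, item 0335, inline) — GRH replaced. -/
theorem collapseEmptiesBoundary_of_tauConstElim_of_ch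
    (hT : VP ℂ = VNP ℂ → IsPBounded (fun n => constantFreeComplexity (perPoly (Fin n) ℤ)))
    (hU : CHClosureDefinable) : CollapseEmptiesBoundary :=
  collapseEmptiesBoundary_of_ch hU fun hEq => pCH_of_tau (hT hEq) hEq

/-- `TauConstElim ∧ Q ∧ U_CH ⟹ ValiantsHypothesis` through the route's `closes`. -/
theorem valiant_of_tauConstElim_of_Q_of_ch
    (hT : VP ℂ = VNP ℂ → IsPBounded (fun n => constantFreeComplexity (perPoly (Fin n) ℤ)))
    (hQ : EmptyBoundarySeparates) (hU : CHClosureDefinable) : ValiantsHypothesis :=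
  closes hQ (collapseEmptiesBoundary_of_tauConstElim_of_ch hT hU)

end Summit.ValiantsHypothesis.ValiantsHypothesis.Theorems.VPBoundarySquareNbBooleanSlot

end
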